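import Mathlib
import Literature.Probability.Percolation.PercolationProofs
import Literature.Probability.LatticeModels.ProdBernoulliIndependence
import Literature.Probability.LatticeModels.ProdBernoulliCoupling
import Literature.Probability.Percolation.KozmaNitzanPinning
import Summits.CriticalPhenomena.PercolationContinuityZ3.Theorems.PercNearOneGluingNoHeavyLowerTailLemma5Slack
import Summits.CriticalPhenomena.PercolationContinuityZ3.Theorems.PercNearOneGluingAdditiveGluingLemma5AnyRelay
import HarnessLib

/-!
# `NoHeavyLowerTail` (stmt-CriticalPhenomena-4575), line fat-minority-linear — EXPLORATION GLUING:
# Kozma–Nitzan's Lemma 5 at an arbitrary EXPLORED CYLINDER (zero slack, any graph, any depth)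

Route task `nh-dp-fatminority` (gen 4).  `μ = prodBernoulli w` on the pairs of `Fin n`.

Every anchored-gluing file of this line (KN Theorem 4 `anchoredGluing`, the block and two-step forms,
`lemma5AnyRelaySlack'`) conditions on the OPEN STAR of the observer `o`: the conditioning event is
`σ_B` and the anchor must be at most as reliable, OFF `o`, as an opened neighbour.  For an observer
attached through private units the opened neighbour is a unit whose non-attachment makes it less
reliable than every relay; the resulting slack `1 - π_x` is the residual "window" of gen 3.

This file removes the restriction to the star.  Let `F` be ANY finite set of pairs ("explored pairs")
and `ξ` a pattern on it; the cylinder `[ξ]_F = {ω | ∀ e ∈ F, e ∈ ω ↔ e ∈ ξ}` is the event "the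
exploration saw exactly `ξ` on `F`".  Let `S` be a block of vertices containing both endpoints of every
OPEN explored pair, `c ∈ S`, `b ∉ S`.  If the anchor `a` is at most as reliable as `c` (up to `η`) in
the graph with ALL explored pairs deleted (`pinW w F ∅`), then

  `μ([ξ]_F ∩ {a ↔ b}) ≤ μ([ξ]_F ∩ {S ↔ b}) + η · μ([ξ]_F)`            (`exploredBlockGluing`),

and if the open explored pairs join every vertex of `S` to `o` (an explored open cluster of `o`),

  `μ([ξ]_F ∩ {o ↮ b}) ≤ μ([ξ]_F ∩ {a ↮ b}) + η · μ([ξ]_F)`            (`exploredCluster_notConn_le`).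

USE (zero slack, `η = 0`): explore `C(o)` pair by pair in ANY adaptive order and stop at the first
relay `c ∈ A` reached; at that leaf the least reliable relay of `G ∖ (explored pairs)` is an admissible
anchor (it is at most as reliable as `c ∈ A` by definition), so `P(o ↮ b, leaf) ≤ P(a_leaf ↮ b, leaf)`
with NO slack and no hypothesis on the depth or geometry of the pocket — KN Theorem 4 is the case where
the exploration is the star of `o` (then `G ∖ explored = G ∖ o` for reliabilities and the anchor never
moves).  The whole difficulty of linear gluing is thereby typed as the combinatorics of the anchor
`a_leaf = argmin_A P_{G ∖ E_leaf}(· ↔ b)` along the exploration (gen-4 NOTES, `## Census`).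

Proof: conditioning on `[ξ]_F` is pinning (`prodBernoulli_real_inter_localCylinder`); the pinned
weighting wired along `S` IS the gluing of the deleted weighting `pinW w F ∅` along `S` (the open
explored pairs lie inside `S`), so `gluingLemma5_slack` (KN Lemma 5 with slack, block form: sprinkling
+ KN Lemma 3(i) + `ε → 0`, landed by lead c2) applies verbatim; wiring is contraction
(`prodBernoulli_wireW_real_openConn`).  No new definitions.
-/

namespace Summit.CriticalPhenomena.PercolationContinuityZ3.Theorems

open MeasureTheory Set
open Literature.Probability.LatticeModels (prodBernoulli)
open Literature.Probability.Percolation (BondConfig openConn openGraph openGraph_adj)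

noncomputable section
open Classical
open Literature.Probability.LatticeModels Literature.Probability.Percolation

variable {n : ℕ}

/-- The pinned weighting of an explored cylinder, wired along a block `S` containing every open
explored pair, is the gluing along `S` of the weighting with all explored pairs deleted. [folklore] -/
theorem wireW_pinW_eq_glue_deleted (w : Sym2 (Fin n) → unitInterval) (F : Finset (Sym2 (Fin n)))
    (ξ : Set (Sym2 (Fin n))) (S : Finset (Fin n))
    (hO : ∀ e ∈ F, e ∈ ξ → (∀ x ∈ e, x ∈ S) ∧ ¬ e.IsDiag) :
    wireW (↑S : Set (Fin n)) (pinW w ↑F ξ) =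
      fun e : Sym2 (Fin n) =>
        if (∀ x ∈ e, x ∈ S) ∧ ¬ e.IsDiag then 1 else pinW w (↑F : Set (Sym2 (Fin n))) ∅ e := by
  funext e
  have hwire : e ∈ wireSet (↑S : Set (Fin n)) ↔ (∀ x ∈ e, x ∈ S) ∧ ¬ e.IsDiag := by
    simp only [wireSet, Set.mem_setOf_eq, Finset.mem_coe]
  by_cases he : (∀ x ∈ e, x ∈ S) ∧ ¬ e.IsDiag
  · rw [if_pos he, wireW_apply_of_mem _ (hwire.2 he)]
  · rw [if_neg he, wireW_apply_of_not_mem _ fun h => he (hwire.1 h)]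
    by_cases heF : e ∈ (↑F : Set (Sym2 (Fin n)))
    · have hξ : e ∉ ξ := fun h => he (hO e (Finset.mem_coe.1 heF) h)
      rw [pinW_apply_of_mem_of_not_mem w heF hξ,
        pinW_apply_of_mem_of_not_mem w heF (Set.notMem_empty e)]
    · rw [pinW_apply_of_not_mem w ξ heF, pinW_apply_of_not_mem w ∅ heF]

/-- Under a wired weighting the block event `{S ↔ b}` has the probability of `{S ↔ b}` under the
unwired one (wiring is contraction, twice, and wiring is idempotent). [folklore] -/
theorem wireW_real_biUnion_openConn (p : Sym2 (Fin n) → unitInterval) (S : Finset (Fin n))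
    {c : Fin n} (hc : c ∈ S) (b : Fin n) :
    (prodBernoulli (wireW (↑S : Set (Fin n)) p)).real (⋃ s ∈ S, openConn s b) =
      (prodBernoulli p).real (⋃ s ∈ S, openConn s b) := by
  have hcS : c ∈ (↑S : Set (Fin n)) := Finset.mem_coe.2 hc
  have h1 : ∀ q : Sym2 (Fin n) → unitInterval,
      (prodBernoulli q).real (⋃ s ∈ S, openConn s b) =
        (prodBernoulli q).real (⋃ t ∈ (↑S : Set (Fin n)), openConn b t) := by
    intro q
    congr 1
    ext ω
    constructor
    · intro h
      obtain ⟨t, ht, hbt⟩ := Set.mem_iUnion₂.1 h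
      exact Set.mem_iUnion₂.2 ⟨t, Finset.mem_coe.2 ht, SimpleGraph.Reachable.symm hbt⟩
    · intro h
      obtain ⟨t, ht, hbt⟩ := Set.mem_iUnion₂.1 h
      exact Set.mem_iUnion₂.2 ⟨t, Finset.mem_coe.1 ht, SimpleGraph.Reachable.symm hbt⟩
  rw [h1, h1, ← prodBernoulli_wireW_real_openConn p _ hcS b,
    ← prodBernoulli_wireW_real_openConn (wireW _ p) _ hcS b, lemma5AnyRelay_wireW_wireW]

/-- **Explored block gluing (KN Lemma 5 at an explored cylinder, with slack).**  `F` a finite set of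
explored pairs with pattern `ξ`, `S` a block of vertices containing both endpoints of every open
explored pair (`e ∈ F`, `e ∈ ξ`), `c ∈ S`, `b ∉ S`.  If the anchor `a` is at most as reliable as `c`, up
to `η ≥ 0`, once all explored pairs are deleted —
`μ_{pinW w F ∅}(a ↔ b) ≤ μ_{pinW w F ∅}(c ↔ b) + η` — then
`μ([ξ]_F ∩ {a ↔ b}) ≤ μ([ξ]_F ∩ {S ↔ b}) + η μ([ξ]_F)`.
[cite: KozmaNitzan2024, §3.2 Lemma 5 (p. 13) and Lemma 3(i) (p. 6)] -/
theorem exploredBlockGluing (w : Sym2 (Fin n) → unitInterval) (F : Finset (Sym2 (Fin n)))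
    (ξ : Set (Sym2 (Fin n))) (S : Finset (Fin n)) (a c b : Fin n) (η : ℝ)
    (hcS : c ∈ S) (hbS : b ∉ S) (hη : 0 ≤ η)
    (hO : ∀ e ∈ F, e ∈ ξ → (∀ x ∈ e, x ∈ S) ∧ ¬ e.IsDiag)
    (hle : (prodBernoulli (pinW w (↑F : Set (Sym2 (Fin n))) ∅)).real (openConn a b) ≤
      (prodBernoulli (pinW w (↑F : Set (Sym2 (Fin n))) ∅)).real (openConn c b) + η) :
    (prodBernoulli w).real (localCylinder (↑F : Set (Sym2 (Fin n))) ξ ∩ openConn a b) ≤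
      (prodBernoulli w).real (localCylinder (↑F : Set (Sym2 (Fin n))) ξ ∩ ⋃ s ∈ S, openConn s b) +
        η * (prodBernoulli w).real (localCylinder (↑F : Set (Sym2 (Fin n))) ξ) := by
  -- conditioning on the cylinder is pinning
  have hcond : ∀ X : Set (BondConfig (Fin n)),
      (prodBernoulli w).real (localCylinder (↑F : Set (Sym2 (Fin n))) ξ ∩ X) =
        (prodBernoulli w).real (localCylinder (↑F : Set (Sym2 (Fin n))) ξ) *
          (prodBernoulli (pinW w ↑F ξ)).real X := fun X => by
    rw [Set.inter_comm]
    exact prodBernoulli_real_inter_localCylinder w F ξ MeasurableSet.of_discrete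
  rw [hcond, hcond, mul_comm η, ← mul_add]
  refine mul_le_mul_of_nonneg_left ?_ measureReal_nonneg
  -- KN Lemma 5 (block form, with slack) for the deleted weighting, glued along `S`
  have hglue := gluingLemma5_slack n (pinW w (↑F : Set (Sym2 (Fin n))) ∅) S a c b η hcS hbS hη hle
  rw [← wireW_pinW_eq_glue_deleted w F ξ S hO] at hglue
  calc (prodBernoulli (pinW w (↑F : Set (Sym2 (Fin n))) ξ)).real (openConn a b)
      ≤ (prodBernoulli (wireW (↑S : Set (Fin n)) (pinW w ↑F ξ))).real (openConn a b) :=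
        prodBernoulli_real_mono_of_isUpperSet (le_wireW _ _) (isUpperSet_openConn a b)
          MeasurableSet.of_discrete
    _ ≤ (prodBernoulli (wireW (↑S : Set (Fin n)) (pinW w ↑F ξ))).real (⋃ s ∈ S, openConn s b) + η :=
        hglue
    _ = (prodBernoulli (pinW w (↑F : Set (Sym2 (Fin n))) ξ)).real (⋃ s ∈ S, openConn s b) + η := by
        rw [wireW_real_biUnion_openConn _ S hcS b]

/-- **Exploration gluing at a vertex.**  Same data; if moreover on the cylinder every vertex of the
block `S` is joined to `o` (e.g. `S` = the vertices of an explored open cluster of `o`), then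
`μ([ξ]_F ∩ {o ↮ b}) ≤ μ([ξ]_F ∩ {a ↮ b}) + η μ([ξ]_F)`: on an explored leaf whose reached vertex `c`
is at least as reliable (in `G ∖` explored pairs, up to `η`) as the anchor `a`, the observer beats the
anchor.  With `η = 0`, `c` the first RELAY reached and `a` the least reliable relay of
`G ∖` explored pairs, the hypothesis holds by definition (zero-slack moving anchor).
[cite: KozmaNitzan2024, §3.2 Lemma 5 (p. 13)] -/
theorem exploredCluster_notConn_le (w : Sym2 (Fin n) → unitInterval) (F : Finset (Sym2 (Fin n)))
    (ξ : Set (Sym2 (Fin n))) (S : Finset (Fin n)) (o a c b : Fin n) (η : ℝ)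
    (hcS : c ∈ S) (hbS : b ∉ S) (hη : 0 ≤ η)
    (hO : ∀ e ∈ F, e ∈ ξ → (∀ x ∈ e, x ∈ S) ∧ ¬ e.IsDiag)
    (hjoin : ∀ ω ∈ localCylinder (↑F : Set (Sym2 (Fin n))) ξ, ∀ s ∈ S, (openGraph ω).Reachable o s)
    (hle : (prodBernoulli (pinW w (↑F : Set (Sym2 (Fin n))) ∅)).real (openConn a b) ≤
      (prodBernoulli (pinW w (↑F : Set (Sym2 (Fin n))) ∅)).real (openConn c b) + η) :
    (prodBernoulli w).real (localCylinder (↑F : Set (Sym2 (Fin n))) ξ ∩ (openConn o b)ᶜ) ≤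
      (prodBernoulli w).real (localCylinder (↑F : Set (Sym2 (Fin n))) ξ ∩ (openConn a b)ᶜ) +
        η * (prodBernoulli w).real (localCylinder (↑F : Set (Sym2 (Fin n))) ξ) := by
  set L : Set (BondConfig (Fin n)) := localCylinder (↑F : Set (Sym2 (Fin n))) ξ with hL
  have hblock := exploredBlockGluing w F ξ S a c b η hcS hbS hη hO hle
  -- on the cylinder, `{S ↔ b} ⊆ {o ↔ b}`
  have hsub : L ∩ (⋃ s ∈ S, openConn s b) ⊆ L ∩ openConn o b := by
    rintro ω ⟨hωL, hω⟩
    obtain ⟨s, hs, hsb⟩ := Set.mem_iUnion₂.1 hω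
    exact ⟨hωL, SimpleGraph.Reachable.trans (hjoin ω hωL s hs) hsb⟩
  have h1 : (prodBernoulli w).real (L ∩ ⋃ s ∈ S, openConn s b) ≤
      (prodBernoulli w).real (L ∩ openConn o b) :=
    measureReal_mono hsub (measure_ne_top _ _)
  -- complements inside the cylinder
  have hsplit : ∀ X : Set (BondConfig (Fin n)),
      (prodBernoulli w).real (L ∩ Xᶜ) = (prodBernoulli w).real L - (prodBernoulli w).real (L ∩ X) := by
    intro X
    have h := measureReal_inter_add_sdiff (μ := prodBernoulli w) (s := L) (t := X)
      (MeasurableSet.of_discrete : MeasurableSet X)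
    rw [Set.sdiff_eq] at h
    linarith
  rw [hsplit, hsplit]
  linarith

end

end Summit.CriticalPhenomena.PercolationContinuityZ3.Theorems
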